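import Mathlib
import Literature.Computability.AlgebraicComplexity.SimultaneousDoubleProduct
import Summits.MatrixMultiplication.MatrixMultiplication.Theorems.EisensteinValCertificatesHomocyclicSTPPDesignsStubLeafPacking
import Summits.MatrixMultiplication.MatrixMultiplication.Theorems.EisensteinValCertificatesHomocyclicSTPPDesignsStubLeafSwap

/-!
# The balanced normal form of the clustered two-families leaf (line `registered` of crux
`EisensteinValCertificates.HomocyclicSTPPDesigns`, stmt-MatrixMultiplication-10647; lead c4, `--supports`)

The open stub of the line, `stub_clusteredTwoFamilies` (the CLUSTERED TWO-FAMILIES LEAF), asks for every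
`ε > 0` for a prime `p`, an SDPP family `(A_i, B_i)_{i<n}` in `ℤ/p` (tree `IsSDPP`) with `|A_i| = a`,
`|B_i| = b`, `ab ≥ 2`, a class map `cls : Fin n → Fin m` with cross-class disjoint difference sets and
classes of size `≥ d`, and merit `m · d^{2/3} · (ab)^{(2+ε)/3} > p`.  The kill items of the sibling route
FourierTwoFamiliesModP (`PrimeCyclicPowerGain`, `PrimeLogDecay`, `PrimeDensityDecay`) speak of BALANCED
configurations `|A_i| = |B_i| = s`.  This file proves that the leaf is EQUIVALENT to its balanced form

  `∀ ε > 0 ∃ p prime, n m s d, A B, cls: IsSDPP A B ∧ 2 ≤ s ∧ (∀ i, |A_i| = s ∧ |B_i| = s) ∧ clustering ∧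
   class sizes ≥ d ∧ p < m · d^{2/3} · (s·s)^{(2+ε)/3}`

(`clusteredTwoFamilies_iff_balanced`, registered closed form on the crux), so that a promoted item may be
filed in either vocabulary.  Proof of (→): take a leaf witness at `ε := ε'/(3+ε')`; WLOG `a ≤ b` (swap
symmetry `stub_leafSwap`); merit cubed and the packings `m·ab ≤ p`, `m·d ≤ n` (`stub_leafPacking`) give
`p² < n²(ab)^{1+ε}`, and `n·b ≤ p` gives `b^{1−ε} < a^{1+ε}` (so `a ≥ 2`); shrinking every `B_i` to `a`
elements (`Finset.exists_subset_card_eq`, `IsSDPP.mono`; difference sets shrink, so the clustering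
survives) keeps merit `m · d^{2/3} · (a·a)^{(2+ε')/3} > p` because `(ab)^{2+ε} < (a²)^{(2+ε)/(1−ε)} ≤
(a²)^{2+ε'}`.  (←) is the special case `a = b = s`.
Sources for the notions: Cohn–Kleinberg–Szegedy–Umans 2005 (arXiv:math/0511460) §4 Def. 4.1; nothing is
cited as a fact.
-/

set_option linter.dupNamespace false
-- (single-conjunct summit: the namespace repeats `MatrixMultiplication`)

namespace Summit.MatrixMultiplication.MatrixMultiplication.Theorems.HomocyclicSTPPDesigns.ClusteredCharts

open Literature.Computability.AlgebraicComplexity Finset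
open scoped Pointwise

/-- The arithmetic of balancing (everything cast to `ℝ` once): from the packings `n·b ≤ p`,
`m·ab ≤ p`, `m·d ≤ n`, the merit at `ε` with `ε(3+ε') ≤ ε'`, and `a ≤ b`, one gets `a ≥ 2` and the
balanced merit `p < m · d^{2/3} · (a·a)^{(2+ε')/3}`. [folklore] -/
private theorem balanced_arith {ε ε' : ℝ} {p n m a b d : ℕ} (hε : 0 < ε) (hε' : 0 < ε')
    (hεε' : ε * (3 + ε') ≤ ε') (ha : 1 ≤ a) (hle : a ≤ b) (hm : 1 ≤ m) (hd : 1 ≤ d)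
    (h2 : n * b ≤ p) (h3 : m * (a * b) ≤ p) (h4 : m * d ≤ n)
    (hmerit : (p : ℝ) < (m : ℝ) * (d : ℝ) ^ ((2 : ℝ) / 3) * ((a * b : ℕ) : ℝ) ^ ((2 + ε) / 3)) :
    2 ≤ a ∧ (p : ℝ) < (m : ℝ) * (d : ℝ) ^ ((2 : ℝ) / 3) * ((a * a : ℕ) : ℝ) ^ ((2 + ε') / 3) := by
  -- casts and signs
  have hb : 1 ≤ b := le_trans ha hle
  have hn : 1 ≤ n := le_trans (Nat.mul_le_mul hm hd) h4
  have hp : 1 ≤ p := le_trans (Nat.mul_le_mul hn hb) h2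
  have hP0 : (0 : ℝ) < p := by exact_mod_cast hp
  have hA : (1 : ℝ) ≤ a := by exact_mod_cast ha
  have hB : (1 : ℝ) ≤ b := by exact_mod_cast hb
  have hM : (1 : ℝ) ≤ m := by exact_mod_cast hm
  have hN : (1 : ℝ) ≤ n := by exact_mod_cast hn
  have hA0 : (0 : ℝ) < a := by linarith
  have hB0 : (0 : ℝ) < b := by linarith
  have hN0 : (0 : ℝ) < n := by linarith
  have hD0 : (0 : ℝ) ≤ d := Nat.cast_nonneg d
  have h2' : (n : ℝ) * b ≤ p := by exact_mod_cast h2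
  have h3' : (m : ℝ) * (a * b) ≤ p := by exact_mod_cast h3
  have h4' : (m : ℝ) * d ≤ n := by exact_mod_cast h4
  have hX0 : (0 : ℝ) < (a : ℝ) * b := mul_pos hA0 hB0
  have hY0 : (0 : ℝ) < (a : ℝ) * a := mul_pos hA0 hA0
  have hmerit' : (p : ℝ) < m * (d : ℝ) ^ ((2 : ℝ) / 3) * ((a : ℝ) * b) ^ ((2 + ε) / 3) := by
    rwa [Nat.cast_mul] at hmerit
  have hε1 : ε < 1 := by nlinarith
  -- merit cubed: `p³ < m³ d² (ab)^{2+ε} ≤ m n² (ab)^{2+ε}`, hence `p² < n² (ab)^{1+ε}`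
  have hcube : (p : ℝ) ^ 3 < (m : ℝ) ^ 3 * (d : ℝ) ^ 2 * ((a : ℝ) * b) ^ (2 + ε) := by
    have h1 : (p : ℝ) ^ 3 < (m * (d : ℝ) ^ ((2 : ℝ) / 3) * ((a : ℝ) * b) ^ ((2 + ε) / 3)) ^ 3 :=
      pow_lt_pow_left₀ hmerit' hP0.le three_ne_zero
    have hD' : ((d : ℝ) ^ ((2 : ℝ) / 3)) ^ 3 = (d : ℝ) ^ 2 := by
      rw [← Real.rpow_natCast ((d : ℝ) ^ ((2 : ℝ) / 3)) 3, ← Real.rpow_mul hD0,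
        ← Real.rpow_natCast (d : ℝ) 2]
      norm_num
    have hX' : (((a : ℝ) * b) ^ ((2 + ε) / 3)) ^ 3 = ((a : ℝ) * b) ^ (2 + ε) := by
      rw [← Real.rpow_natCast (((a : ℝ) * b) ^ ((2 + ε) / 3)) 3, ← Real.rpow_mul hX0.le]
      congr 1
      push_cast
      ring
    calc (p : ℝ) ^ 3 < (m * (d : ℝ) ^ ((2 : ℝ) / 3) * ((a : ℝ) * b) ^ ((2 + ε) / 3)) ^ 3 := h1
      _ = (m : ℝ) ^ 3 * ((d : ℝ) ^ ((2 : ℝ) / 3)) ^ 3 * (((a : ℝ) * b) ^ ((2 + ε) / 3)) ^ 3 := by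
          rw [mul_pow, mul_pow]
      _ = (m : ℝ) ^ 3 * (d : ℝ) ^ 2 * ((a : ℝ) * b) ^ (2 + ε) := by rw [hD', hX']
  have hP2 : (p : ℝ) ^ 2 < (n : ℝ) ^ 2 * ((a : ℝ) * b) ^ (1 + ε) := by
    have hsplit : ((a : ℝ) * b) ^ (2 + ε) = ((a : ℝ) * b) * ((a : ℝ) * b) ^ (1 + ε) := by
      have e : (2 + ε) = 1 + (1 + ε) := by ring
      rw [e, Real.rpow_add hX0, Real.rpow_one]
    have hmn : (m : ℝ) ^ 3 * (d : ℝ) ^ 2 ≤ m * (n : ℝ) ^ 2 := by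
      have hmd0 : 0 ≤ (m : ℝ) * d := by positivity
      calc (m : ℝ) ^ 3 * (d : ℝ) ^ 2 = m * ((m : ℝ) * d) ^ 2 := by ring
        _ ≤ m * (n : ℝ) ^ 2 := by gcongr
    have hle1 : (m : ℝ) ^ 3 * (d : ℝ) ^ 2 * ((a : ℝ) * b) ^ (2 + ε) ≤
        p * ((n : ℝ) ^ 2 * ((a : ℝ) * b) ^ (1 + ε)) := by
      rw [hsplit]
      calc (m : ℝ) ^ 3 * (d : ℝ) ^ 2 * (((a : ℝ) * b) * ((a : ℝ) * b) ^ (1 + ε))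
          ≤ m * (n : ℝ) ^ 2 * (((a : ℝ) * b) * ((a : ℝ) * b) ^ (1 + ε)) := by gcongr
        _ = ((m : ℝ) * (a * b)) * ((n : ℝ) ^ 2 * ((a : ℝ) * b) ^ (1 + ε)) := by ring
        _ ≤ p * ((n : ℝ) ^ 2 * ((a : ℝ) * b) ^ (1 + ε)) := by gcongr
    have hlt : (p : ℝ) * (p : ℝ) ^ 2 < p * ((n : ℝ) ^ 2 * ((a : ℝ) * b) ^ (1 + ε)) := by
      have h33 : (p : ℝ) * (p : ℝ) ^ 2 = (p : ℝ) ^ 3 := by ring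
      rw [h33]
      exact hcube.trans_le hle1
    exact lt_of_mul_lt_mul_left hlt hP0.le
  -- logarithms: `(1−ε) log b < (1+ε) log a`
  have hlogab : Real.log ((a : ℝ) * b) = Real.log a + Real.log b :=
    Real.log_mul hA0.ne' hB0.ne'
  have hL1 : 2 * Real.log p < 2 * Real.log n + (1 + ε) * (Real.log a + Real.log b) := by
    have h := Real.log_lt_log (pow_pos hP0 2) hP2
    rw [Real.log_pow, Real.log_mul (pow_pos hN0 2).ne' (Real.rpow_pos_of_pos hX0 _).ne',
      Real.log_pow, Real.log_rpow hX0, hlogab] at h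
    exact_mod_cast h
  have hL2 : Real.log n + Real.log b ≤ Real.log p := by
    have h := Real.log_le_log (mul_pos hN0 hB0) h2'
    rwa [Real.log_mul hN0.ne' hB0.ne'] at h
  have hla : 0 ≤ Real.log a := Real.log_nonneg hA
  have hlb : 0 ≤ Real.log b := Real.log_nonneg hB
  have hkey : (1 - ε) * Real.log b < (1 + ε) * Real.log a := by linarith
  -- `a ≥ 2`
  have ha2 : 2 ≤ a := by
    by_contra hlt
    have ha1 : a = 1 := by omega
    have hla0 : Real.log a = 0 := by rw [ha1, Nat.cast_one, Real.log_one]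
    rw [hla0, mul_zero] at hkey
    have : 0 ≤ (1 - ε) * Real.log b := mul_nonneg (by linarith) hlb
    linarith
  refine ⟨ha2, ?_⟩
  -- the balanced merit: `(ab)^{(2+ε)/3} ≤ (a·a)^{(2+ε')/3}`
  have hexp : ((a : ℝ) * b) ^ ((2 + ε) / 3) ≤ ((a : ℝ) * a) ^ ((2 + ε') / 3) := by
    rw [← Real.log_le_log_iff (Real.rpow_pos_of_pos hX0 _) (Real.rpow_pos_of_pos hY0 _),
      Real.log_rpow hX0, Real.log_rpow hY0, hlogab, Real.log_mul hA0.ne' hA0.ne']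
    -- `(2+ε)(log a + log b) ≤ (2+ε')·2 log a`, from `hkey` and `ε(3+ε') ≤ ε'`
    have h1 : (1 - ε) * ((2 + ε) * (Real.log a + Real.log b)) ≤
        (1 - ε) * ((2 + ε') * (Real.log a + Real.log a)) := by
      have hc : (2 + ε) ≤ (1 - ε) * (2 + ε') := by nlinarith
      have hpos : 0 < 2 + ε := by linarith
      nlinarith [mul_le_mul_of_nonneg_right hc (mul_nonneg two_pos.le hla),
        mul_lt_mul_of_pos_left hkey hpos]
    have h1' := le_of_mul_le_mul_left h1 (by linarith : (0 : ℝ) < 1 - ε)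
    linarith
  calc (p : ℝ) < m * (d : ℝ) ^ ((2 : ℝ) / 3) * ((a : ℝ) * b) ^ ((2 + ε) / 3) := hmerit'
    _ ≤ m * (d : ℝ) ^ ((2 : ℝ) / 3) * ((a : ℝ) * a) ^ ((2 + ε') / 3) := by gcongr
    _ = (m : ℝ) * (d : ℝ) ^ ((2 : ℝ) / 3) * ((a * a : ℕ) : ℝ) ^ ((2 + ε') / 3) := by
        rw [Nat.cast_mul]


/-- The balancing step for `a ≤ b`: shrink every `B_i` to `a` elements.  The sub-family keeps the SDPP
(`IsSDPP.mono`), the clustering (difference sets shrink) and the class sizes, and by `balanced_arith`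
(fed with the packings of `stub_leafPacking`) it has `a ≥ 2` and the balanced merit at `ε'`.
[folklore] -/
private theorem balanced_core {ε ε' : ℝ} (hε : 0 < ε) (hε' : 0 < ε') (hεε' : ε * (3 + ε') ≤ ε')
    {p n m a b d : ℕ} (hp : p.Prime) {A B : Fin n → Finset (ZMod p)} {cls : Fin n → Fin m}
    (hS : IsSDPP A B) (hab : 2 ≤ a * b) (hle : a ≤ b)
    (hcard : ∀ i, (A i).card = a ∧ (B i).card = b)
    (hclust : ∀ i j, cls i ≠ cls j → Disjoint (A i - B i) (A j - B j))
    (hsize : ∀ c : Fin m, d ≤ (Finset.univ.filter fun i => cls i = c).card)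
    (hmerit : (p : ℝ) < (m : ℝ) * (d : ℝ) ^ ((2 : ℝ) / 3) * ((a * b : ℕ) : ℝ) ^ ((2 + ε) / 3)) :
    ∃ (s : ℕ) (B' : Fin n → Finset (ZMod p)), IsSDPP A B' ∧ 2 ≤ s ∧
      (∀ i, (A i).card = s ∧ (B' i).card = s) ∧
      (∀ i j, cls i ≠ cls j → Disjoint (A i - B' i) (A j - B' j)) ∧
      (p : ℝ) < (m : ℝ) * (d : ℝ) ^ ((2 : ℝ) / 3) * ((s * s : ℕ) : ℝ) ^ ((2 + ε') / 3) := by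
  have ha : 1 ≤ a := Nat.pos_of_ne_zero fun h => by simp [h] at hab
  have hb : 1 ≤ b := Nat.pos_of_ne_zero fun h => by simp [h] at hab
  have hm : 1 ≤ m := Nat.pos_of_ne_zero fun h => by
    rw [h, Nat.cast_zero, zero_mul, zero_mul] at hmerit
    exact not_lt.2 (Nat.cast_nonneg _) hmerit
  have hd : 1 ≤ d := Nat.pos_of_ne_zero fun h => by
    rw [h, Nat.cast_zero, Real.zero_rpow (by norm_num), mul_zero, zero_mul] at hmerit
    exact not_lt.2 (Nat.cast_nonneg _) hmerit
  obtain ⟨-, h2, h3, h4, -, -⟩ := stub_leafPacking p n m a b d hp A B cls hS ha hb hcard hclust hd hsize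
  obtain ⟨ha2, hmerit'⟩ := balanced_arith hε hε' hεε' ha hle hm hd h2 h3 h4 hmerit
  have hex : ∀ i, ∃ t ⊆ B i, t.card = a := fun i =>
    Finset.exists_subset_card_eq (by rw [(hcard i).2]; exact hle)
  choose B' hB'sub hB'card using hex
  refine ⟨a, B', hS.mono (fun _ => Finset.Subset.rfl) hB'sub, ha2,
    fun i => ⟨(hcard i).1, hB'card i⟩, fun i j hij => ?_, hmerit'⟩
  exact Disjoint.mono (Finset.sub_subset_sub Finset.Subset.rfl (hB'sub i))
    (Finset.sub_subset_sub Finset.Subset.rfl (hB'sub j)) (hclust i j hij)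

/-- **The clustered two-families leaf is equivalent to its balanced form** (registered closed form on
crux stmt-MatrixMultiplication-10647, stub `clusteredTwoFamilies_iff_balanced`; calibration, not used by
the composition).  Left: the open stub `stub_clusteredTwoFamilies` of line `registered` verbatim.  Right:
the same with `|A_i| = |B_i| = s ≥ 2` and merit `m · d^{2/3} · (s·s)^{(2+ε)/3} > p` — the vocabulary of the
kill items `PrimeCyclicPowerGain` / `PrimeLogDecay` / `PrimeDensityDecay` of route FourierTwoFamiliesModP.
(→): witness at `ε'/(3+ε')`, WLOG `a ≤ b` by the swap symmetry `stub_leafSwap`, then `balanced_core`;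
(←): `a = b = s`. [folklore] -/
theorem clusteredTwoFamilies_iff_balanced :
    (∀ ε : ℝ, 0 < ε → ∃ p : ℕ, p.Prime ∧ ∃ (n m a b d : ℕ) (A B : Fin n → Finset (ZMod p))
      (cls : Fin n → Fin m), IsSDPP A B ∧ 2 ≤ a * b ∧ (∀ i, (A i).card = a ∧ (B i).card = b) ∧
      (∀ i j, cls i ≠ cls j → Disjoint (A i - B i) (A j - B j)) ∧
      (∀ c : Fin m, d ≤ (Finset.univ.filter fun i => cls i = c).card) ∧
      (p : ℝ) < (m : ℝ) * (d : ℝ) ^ ((2 : ℝ) / 3) * ((a * b : ℕ) : ℝ) ^ ((2 + ε) / 3)) ↔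
    (∀ ε : ℝ, 0 < ε → ∃ p : ℕ, p.Prime ∧ ∃ (n m s d : ℕ) (A B : Fin n → Finset (ZMod p))
      (cls : Fin n → Fin m), IsSDPP A B ∧ 2 ≤ s ∧ (∀ i, (A i).card = s ∧ (B i).card = s) ∧
      (∀ i j, cls i ≠ cls j → Disjoint (A i - B i) (A j - B j)) ∧
      (∀ c : Fin m, d ≤ (Finset.univ.filter fun i => cls i = c).card) ∧
      (p : ℝ) < (m : ℝ) * (d : ℝ) ^ ((2 : ℝ) / 3) * ((s * s : ℕ) : ℝ) ^ ((2 + ε) / 3)) := by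
  constructor
  · intro hLeaf ε' hε'
    have h3 : (0 : ℝ) < 3 + ε' := by linarith
    set ε : ℝ := ε' / (3 + ε') with hεdef
    have hε : 0 < ε := div_pos hε' h3
    have hεε' : ε * (3 + ε') ≤ ε' := by
      rw [hεdef, div_mul_cancel₀ _ h3.ne']
    obtain ⟨p, hp, n, m, a, b, d, A, B, cls, hS, hab, hcard, hclust, hsize, hmerit⟩ := hLeaf ε hε
    rcases le_total a b with hle | hle
    · obtain ⟨s, B', hS', hs, hcard', hclust', hmerit'⟩ :=
        balanced_core hε hε' hεε' hp hS hab hle hcard hclust hsize hmerit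
      exact ⟨p, hp, n, m, s, d, A, B', cls, hS', hs, hcard', hclust', hsize, hmerit'⟩
    · -- `b ≤ a`: swap the two families first
      obtain ⟨hS2, hclust2⟩ := stub_leafSwap p n m A B cls hS hclust
      have hab2 : 2 ≤ b * a := by rwa [mul_comm]
      have hcard2 : ∀ i, (B i).card = b ∧ (A i).card = a := fun i => ⟨(hcard i).2, (hcard i).1⟩
      have hmerit2 : (p : ℝ) < (m : ℝ) * (d : ℝ) ^ ((2 : ℝ) / 3) *
          ((b * a : ℕ) : ℝ) ^ ((2 + ε) / 3) := by
        rwa [mul_comm b a]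
      obtain ⟨s, A', hS', hs, hcard', hclust', hmerit'⟩ :=
        balanced_core hε hε' hεε' hp hS2 hab2 hle hcard2 hclust2 hsize hmerit2
      exact ⟨p, hp, n, m, s, d, B, A', cls, hS', hs, hcard', hclust', hsize, hmerit'⟩
  · intro hBal ε hε
    obtain ⟨p, hp, n, m, s, d, A, B, cls, hS, hs, hcard, hclust, hsize, hmerit⟩ := hBal ε hε
    exact ⟨p, hp, n, m, s, s, d, A, B, cls, hS, le_trans hs (Nat.le_mul_of_pos_right s (by omega)),
      hcard, hclust, hsize, hmerit⟩

end Summit.MatrixMultiplication.MatrixMultiplication.Theorems.HomocyclicSTPPDesigns.ClusteredCharts
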